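import Summits.HodgeConjecture.CorCM.GaloisIndexTwoAbelianRank
import Summits.HodgeConjecture.CorCM.GaloisTwoPowerStructuredHodge
import HarnessLib

/-!
# The index-two world, residual case `A = C_{2^(n-2)} × C₂`: complex conjugation lies in the cyclic factor, and for
# `[K:ℚ] ≥ 128` the field is structured — unconditionally

COR-CM (cell `pub-hodgecm2`), binder seat b04 (gen 35), count-neutral own lane «Galois-CM-type classification».  KERNEL ONLY:
theorems; no definition, no named fact, no `sorry`.  `HC_CM` is neither used nor claimed.

`K` Galois CM of degree `2^n`, GOOD (every primitive CM type nondegenerate); `A ≤ Gal(K/ℚ)` abelian of index `2` containing complex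
conjugation `c` and an element `g` of order `2^(n-2)` (so `A = ⟨g⟩ × C₂` unless `A` is cyclic).  By `CorCM/GaloisIndexTwoAbelianRank`
this is the only shape of `A` left open by the two-cyclic criterion; A7-JUNCTION gen-34 §C settled it by hand, action by action.
HERE, uniformly and without any degree-`32` hypothesis:

* **`complexConj_mem_zpowers_of_index_two_abelian`** (`n ≥ 6`) — `c ∈ ⟨g⟩` (so `c = g^(2^(n-3))`): otherwise `u₀ = g^(2^(n-3)) c`,
  `u₁ = g⁴` is a two-cyclic pair in `A` (`u₀` is a central involution, `4·|u₁| = 2^(n-2) < |A|`) — BAD.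
* **`pow_four_sq_of_index_two_abelian`** (`n ≥ 7`) — (H2): every `σ` with `σ⁴ = 1` has `σ² ∈ {1, c}`.  A violator `σ` (`σ² = t ∉ {1, c}`,
  a central involution) lies outside `A` (inside, squares lie in `⟨g⟩`, whose involution is `c`); if `σ` commutes with `g²`, then
  `⟨g², σ⟩ ≅ C_{2^(n-3)} × C₄` has index `2` and contains `c = (g²)^(2^(n-4)) ≠ σ²` — BAD by gen 34's
  `CorCM/GaloisCyclicTimesFourIndexTwoDegenerate`; if not, `(gσ)(σg)⁻¹ ∉ {1, t}` (either value would make `σ` commute with `g²`),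
  i.e. `σ⟨t⟩` is a non-central involution of `Gal/⟨t⟩` — BAD by gen 34's quotient criterion (`|Gal| ≥ 104`, whence `n ≥ 7`).
* **`struct_of_index_two_abelian`** (`n ≥ 7`) — hence STRUCT (gen 34's (R1)): `Gal(K/ℚ) ∈ {C, Q, C × C₂, Q × C₂}`; with
  `CorCM/GaloisTwoPowerStructuredNondegenerate` an equivalence `good_iff_struct_of_index_two_abelian`; with
  `CorCM/GaloisTwoPowerStructuredHodge` **`hodgeConjectureFor_pow_of_index_two_abelian`**: the Hodge conjecture for every power of
  every abelian variety with CM by such a field.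
At `n = 6` the second step meets the order-`32` CM quotients `D₃₂`, `SD₃₂` (census rows, not uniform theorems) — consistent with
the degree-`32` base of `CorCM/GaloisTwoPowerClassification`.

## References

* [Kubota1965] T. Kubota, *On the field extension by complex multiplication*, Trans. AMS 118 (1965), §2 and §4 Lemma 2.
* [Shimura1998] G. Shimura, *Abelian Varieties with Complex Multiplication and Modular Functions*, §6.2 Thm. 3, §8.2 Prop. 26, §32.10.
* [Rotman1995] J. J. Rotman, *An Introduction to the Theory of Groups*, 4th ed., GTM 148, Springer 1995, Thm. 5.46.
* [Gordon1999HodgeAVSurvey] B. B. Gordon, *A survey of the Hodge conjecture for abelian varieties*, Thm. 6.4, §9.3, §9.4.3.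
-/

noncomputable section

open CategoryTheory CategoryTheory.Limits NumberField
open scoped BigOperators

namespace Summit.HodgeConjecture.CorCM.GaloisModels

open Literature.NumberTheory.ComplexMultiplication
open Literature.AlgebraicGeometry.Motives (AbelianVariety CMType)
open Literature.AlgebraicGeometry.HodgeTheory
open Literature.AlgebraicGeometry.Pohlmann1968
open Summit.HodgeConjecture.CorCM.GaloisRank

variable {K : Type} [Field K] [NumberField K] [IsCMField K] [IsGalois ℚ K]

/-- **`c` LIES IN THE CYCLIC FACTOR.**  `K` Galois CM of degree `2^n`, `n ≥ 6`, every primitive CM type nondegenerate; `A ≤ Gal(K/ℚ)`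
abelian of index `2` containing complex conjugation `c` and an element `g` of order `2^(n-2)`.  Then `c ∈ ⟨g⟩`, indeed
`c = g^(2^(n-3))`.  (Otherwise the central involution `u₀ = g^(2^(n-3)) c` and `u₁ = g⁴` form a two-cyclic pair in `A`: BAD.)
[cite: Kubota1965, §2 and §4 Lemma 2] [cite: Shimura1998, §8.2 Prop. 26 and §32.10] [cite: Gordon1999HodgeAVSurvey, Thm. 6.4 and §9.3] -/
theorem complexConj_mem_zpowers_of_index_two_abelian {n : ℕ} (hdeg : Module.finrank ℚ K = 2 ^ n) (hn : 6 ≤ n)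
    (hgood : ∀ (Φ : CMType K) (φ : K →+* ℂ), IsPrimitive (ℂ ≃+* ℂ) Φ.1 φ → IsNondegenerate Φ)
    (A : Subgroup (K ≃ₐ[ℚ] K)) (hAidx : A.index = 2) (hcommA : ∀ u ∈ A, ∀ v ∈ A, u * v = v * u)
    (hcA : (IsCMField.complexConj K).restrictScalars ℚ ∈ A) (g : K ≃ₐ[ℚ] K) (hgA : g ∈ A) (hg : orderOf g = 2 ^ (n - 2)) :
    (IsCMField.complexConj K).restrictScalars ℚ ∈ Subgroup.zpowers g ∧
      (IsCMField.complexConj K).restrictScalars ℚ = g ^ 2 ^ (n - 3) := by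
  classical
  set c := (IsCMField.complexConj K).restrictScalars ℚ with hc
  have hcc : c * c = 1 := model_complexConj_mul_self (MulEquiv.refl (K ≃ₐ[ℚ] K)) (by simp [hc])
  have hc1 : c ≠ 1 := model_complexConj_ne_one (MulEquiv.refl (K ≃ₐ[ℚ] K)) (by simp [hc])
  have hccen : ∀ x : K ≃ₐ[ℚ] K, x * c = c * x := fun x =>
    (model_complexConj_comm (MulEquiv.refl (K ≃ₐ[ℚ] K)) (by simp [hc]) x).symm
  have h64 : 64 ≤ 2 ^ n := le_trans (by norm_num) (Nat.pow_le_pow_right (by norm_num) hn : 2 ^ 6 ≤ 2 ^ n)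
  have h52 : 52 ≤ Module.finrank ℚ K := by rw [hdeg]; omega
  -- the involution `g₀ = g^(2^(n-3))` of `⟨g⟩`
  set g₀ := g ^ 2 ^ (n - 3) with hg₀
  have hg₀g₀ : g₀ * g₀ = 1 := by
    rw [hg₀, ← pow_add, ← two_mul, ← pow_succ', show n - 3 + 1 = n - 2 by omega, ← hg, pow_orderOf_eq_one]
  have hg₀1 : g₀ ≠ 1 := by
    intro h
    have h2 := orderOf_dvd_of_pow_eq_one h
    rw [hg] at h2
    have := (Nat.pow_dvd_pow_iff_le_right (by norm_num : 1 < 2)).1 h2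
    omega
  have hg₀cen : ∀ x : K ≃ₐ[ℚ] K, x * g₀ = g₀ * x := fun x =>
    commute_of_involution_of_forall_isNondegenerate_of_le h52 hgood g₀ hg₀g₀ x
  have hg₀mem : g₀ ∈ Subgroup.zpowers g := Subgroup.npow_mem_zpowers g _
  -- `c ∈ ⟨g⟩`
  have hcg : c ∈ Subgroup.zpowers g := by
    by_contra hcg
    have hg4mem : g ^ 4 ∈ Subgroup.zpowers g := Subgroup.npow_mem_zpowers g 4
    have hog4 : orderOf (g ^ 4) = 2 ^ (n - 4) := by
      rw [orderOf_pow_of_dvd (by norm_num) (by rw [hg, show n - 2 = (n - 4) + 2 by omega, pow_add]; exact Dvd.intro_left _ rfl), hg,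
        show 2 ^ (n - 2) = 2 ^ (n - 4) * 4 by rw [show n - 2 = (n - 4) + 2 by omega, pow_add]; norm_num, Nat.mul_div_cancel _ (by norm_num)]
    -- elements of `⟨g⟩` times `c` are not in `⟨g⟩`
    have hnot : ∀ w ∈ Subgroup.zpowers g, w * c ∉ Subgroup.zpowers g := fun w hw h => hcg (by
      have := Subgroup.mul_mem _ (Subgroup.inv_mem _ hw) h
      rwa [inv_mul_cancel_left] at this)
    -- membership in `⟨g₀ c, c⟩ = {1, g₀c, c, g₀}`
    have hmem_cl : ∀ w ∈ Subgroup.closure ({g₀ * c, c} : Set (K ≃ₐ[ℚ] K)), w = 1 ∨ w = g₀ * c ∨ w = c ∨ w = g₀ := by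
      intro w hw
      have hcomm' : g₀ * c * c = c * (g₀ * c) := hccen (g₀ * c)
      obtain ⟨i, j, rfl⟩ := CyclicTimesFour.exists_eq_zpow_mul_zpow hcomm' hw
      have hu : g₀ * c * (g₀ * c) = 1 := by
        rw [show g₀ * c * (g₀ * c) = g₀ * (c * g₀) * c by group, ← hccen g₀, show g₀ * (g₀ * c) * c = g₀ * g₀ * (c * c) by group,
          hg₀g₀, hcc, one_mul]
      rcases zpow_eq_one_or_eq_of_mul_self_eq_one hu i with h | h <;>
        rcases zpow_eq_one_or_eq_of_mul_self_eq_one hcc j with h' | h' <;> rw [h, h']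
      · exact Or.inl (one_mul _)
      · exact Or.inr (Or.inr (Or.inl (one_mul _)))
      · exact Or.inr (Or.inl (mul_one _))
      · exact Or.inr (Or.inr (Or.inr (by rw [mul_assoc, hcc, mul_one])))
    obtain ⟨Φ, φ, X, ι, ϑ, H1, H2, -⟩ := exists_simple_degenerate_of_index_two_pair hdeg (by omega) A hAidx hcommA hcA
      (g₀ * c) (g ^ 4) (A.mul_mem (A.pow_mem hgA _) hcA) (A.pow_mem hgA 4)
      (fun h => by
        rcases (mem_zpowers_iff_of_mul_self_eq_one (by
          rw [show g₀ * c * (g₀ * c) = g₀ * (c * g₀) * c by group, ← hccen g₀,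
            show g₀ * (g₀ * c) * c = g₀ * g₀ * (c * c) by group, hg₀g₀, hcc, one_mul]) c).1 h with h | h
        · exact hc1 h
        · exact hg₀1 (mul_right_cancel (a := 1) (by rw [one_mul]; exact h)).symm)
      (fun h => hcg (Subgroup.zpowers_le.2 hg4mem h))
      (fun h => hcg (by
        have : c = g₀⁻¹ := eq_inv_of_mul_eq_one_right h |>.symm ▸ (eq_inv_of_mul_eq_one_right h) ▸ rfl
        rw [mul_eq_one_iff_inv_eq] at h
        rw [← h]
        exact Subgroup.inv_mem _ hg₀mem))
      (fun h => by
        rcases hmem_cl _ h with h | h | h | h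
        · have h2 := orderOf_dvd_of_pow_eq_one h
          rw [hg] at h2
          have : 2 ^ (n - 2) ≤ 4 := Nat.le_of_dvd (by norm_num) h2
          have : 2 ^ 4 ≤ 2 ^ (n - 2) := Nat.pow_le_pow_right (by norm_num) (by omega)
          omega
        · exact hnot g₀ hg₀mem (h ▸ hg4mem)
        · exact hcg (h ▸ hg4mem)
        · -- `g⁴ = g₀` contradicts the orders
          have h1 : orderOf (g ^ 4) = 2 := by rw [h]; exact orderOf_eq_prime (by rw [pow_two, hg₀g₀]) hg₀1
          rw [hog4] at h1
          have := Nat.pow_right_injective le_rfl (h1.trans (pow_one 2).symm)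
          omega)
      (fun w hw₀ hw₁ => by
        rcases (mem_zpowers_iff_of_mul_self_eq_one (by
          rw [show g₀ * c * (g₀ * c) = g₀ * (c * g₀) * c by group, ← hccen g₀,
            show g₀ * (g₀ * c) * c = g₀ * g₀ * (c * c) by group, hg₀g₀, hcc, one_mul]) w).1 hw₀ with h | h
        · exact h
        · exact absurd (Subgroup.zpowers_le.2 hg4mem (h ▸ hw₁)) (hnot g₀ hg₀mem))
      (fun x h => by
        have e : x * (g₀ * c) * x⁻¹ = g₀ * c := by
          calc x * (g₀ * c) * x⁻¹ = (x * g₀) * c * x⁻¹ := by group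
            _ = g₀ * (x * c) * x⁻¹ := by rw [hg₀cen x]; group
            _ = g₀ * (c * x) * x⁻¹ := by rw [hccen x]
            _ = g₀ * c := by group
        rw [e] at h
        exact hnot g₀ hg₀mem (Subgroup.zpowers_le.2 hg4mem h))
      (by
        rw [orderOf_eq_prime (p := 2) (by
          rw [pow_two, show g₀ * c * (g₀ * c) = g₀ * (c * g₀) * c by group, ← hccen g₀,
            show g₀ * (g₀ * c) * c = g₀ * g₀ * (c * c) by group, hg₀g₀, hcc, one_mul])
          (fun h => hcg (by rw [mul_eq_one_iff_inv_eq] at h; rw [← h]; exact Subgroup.inv_mem _ hg₀mem))]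
        have : 2 ^ 5 ≤ 2 ^ (n - 1) := Nat.pow_le_pow_right (by norm_num) (by omega)
        omega)
      (by
        rw [hog4, show 4 * 2 ^ (n - 4) = 2 ^ (n - 2) by rw [show n - 2 = (n - 4) + 2 by omega, pow_add]; ring]
        exact Nat.pow_lt_pow_right (by norm_num) (by omega))
    exact H2 (hgood Φ φ H1)
  refine ⟨hcg, ?_⟩
  exact involution_eq_of_mem_zpowers hg hcg hcc hc1 hg₀mem hg₀g₀ hg₀1

/-- **(H2) IN THE INDEX-TWO WORLD, residual case** (`n ≥ 7`, unconditional): `K` Galois CM of degree `2^n`, every primitive CM type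
nondegenerate, `A ≤ Gal(K/ℚ)` abelian of index `2` containing `c` and an element `g` of order `2^(n-2)`.  Then every `σ` with `σ⁴ = 1`
has `σ² ∈ {1, c}`.  (A violator lies outside `A`; if it commutes with `g²` the `C_{2^(n-3)} × C₄`-criterion applies, if not it is a
non-central involution of `Gal/⟨σ²⟩`.) [cite: Kubota1965, §2 and §4 Lemma 2] [cite: Shimura1998, §8.2 Prop. 26 and §32.10]
[cite: Rotman1995, Thm. 5.46] -/
theorem pow_four_sq_of_index_two_abelian {n : ℕ} (hdeg : Module.finrank ℚ K = 2 ^ n) (hn : 7 ≤ n)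
    (hgood : ∀ (Φ : CMType K) (φ : K →+* ℂ), IsPrimitive (ℂ ≃+* ℂ) Φ.1 φ → IsNondegenerate Φ)
    (A : Subgroup (K ≃ₐ[ℚ] K)) (hAidx : A.index = 2) (hcommA : ∀ u ∈ A, ∀ v ∈ A, u * v = v * u)
    (hcA : (IsCMField.complexConj K).restrictScalars ℚ ∈ A) (g : K ≃ₐ[ℚ] K) (hgA : g ∈ A) (hg : orderOf g = 2 ^ (n - 2))
    (σ : K ≃ₐ[ℚ] K) (hσ : σ ^ 4 = 1) : σ * σ = 1 ∨ σ * σ = (IsCMField.complexConj K).restrictScalars ℚ := by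
  classical
  by_contra hcon
  obtain ⟨hσ1, hσc⟩ := not_or.1 hcon
  set c := (IsCMField.complexConj K).restrictScalars ℚ with hc
  have hcc : c * c = 1 := model_complexConj_mul_self (MulEquiv.refl (K ≃ₐ[ℚ] K)) (by simp [hc])
  have hc1 : c ≠ 1 := model_complexConj_ne_one (MulEquiv.refl (K ≃ₐ[ℚ] K)) (by simp [hc])
  have hcardF : Fintype.card (K ≃ₐ[ℚ] K) = 2 ^ n := by rw [card_model_eq_finrank (MulEquiv.refl (K ≃ₐ[ℚ] K)), hdeg]
  have hcard : Nat.card (K ≃ₐ[ℚ] K) = 2 ^ n := by rw [Nat.card_eq_fintype_card, hcardF]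
  have h128 : 128 ≤ 2 ^ n := le_trans (by norm_num) (Nat.pow_le_pow_right (by norm_num) hn : 2 ^ 7 ≤ 2 ^ n)
  have h52 : 52 ≤ Module.finrank ℚ K := by rw [hdeg]; omega
  obtain ⟨hcg, hcg₀⟩ := complexConj_mem_zpowers_of_index_two_abelian hdeg (by omega) hgood A hAidx hcommA hcA g hgA hg
  rw [← hc] at hcg hcg₀
  -- the central involution `t = σ²`
  set t := σ * σ with ht
  have htt : t * t = 1 := by
    rw [ht, show σ * σ * (σ * σ) = σ ^ 4 by simp only [pow_succ, pow_zero, one_mul, mul_assoc]]; exact hσ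
  have htcen : ∀ x : K ≃ₐ[ℚ] K, x * t = t * x := fun x =>
    commute_of_involution_of_forall_isNondegenerate_of_le h52 hgood t htt x
  -- `t ∉ ⟨g⟩`: the involution of `⟨g⟩` is `c`
  have htg : t ∉ Subgroup.zpowers g := fun h => hσc (involution_eq_of_mem_zpowers hg h htt hσ1 hcg hcc hc1)
  -- `σ ∉ A`: inside `A = ⟨g⟩ × ⟨t⟩` squares lie in `⟨g⟩`
  have hσA : σ ∉ A := by
    intro hσA
    have htA : t ∈ A := A.mul_mem hσA hσA
    -- `closure {g, t} = A` by cardinality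
    have hgt : g * t = t * g := htcen g
    have hint : ∀ w : K ≃ₐ[ℚ] K, w ∈ Subgroup.zpowers g → w ∈ Subgroup.zpowers t → w = 1 := by
      intro w hwg hwt
      rcases (mem_zpowers_iff_of_mul_self_eq_one htt w).1 hwt with h | h
      · exact h
      · exact absurd (h ▸ hwg) htg
    have hle : Subgroup.closure ({g, t} : Set (K ≃ₐ[ℚ] K)) ≤ A := by
      rw [Subgroup.closure_le]
      intro w hw
      simp only [Set.mem_insert_iff, Set.mem_singleton_iff] at hw
      rcases hw with rfl | rfl
      · exact hgA
      · exact htA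
    have hcardA : Nat.card A = 2 ^ (n - 1) := by
      have h1 := A.index_mul_card
      rw [hAidx, hcard, show 2 ^ n = 2 * 2 ^ (n - 1) by rw [← pow_succ', Nat.sub_add_cancel (by omega)]] at h1
      exact Nat.eq_of_mul_eq_mul_left (by norm_num) h1
    have hge : Nat.card A ≤ Nat.card (Subgroup.closure ({g, t} : Set (K ≃ₐ[ℚ] K))) := by
      have h1 := CyclicTimesFour.mul_card_le_card_closure hint
      rw [hg, orderOf_eq_prime (by rw [pow_two, htt]) hσ1] at h1
      rw [hcardA, show 2 ^ (n - 1) = 2 ^ (n - 2) * 2 by rw [← pow_succ, show n - 2 + 1 = n - 1 by omega]]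
      exact h1
    have heq : Subgroup.closure ({g, t} : Set (K ≃ₐ[ℚ] K)) = A := le_antisymm hle (Subgroup.eq_of_le_of_card_ge hle hge).ge
    obtain ⟨i, j, hij⟩ := CyclicTimesFour.exists_eq_zpow_mul_zpow hgt (heq ▸ hσA : σ ∈ Subgroup.closure ({g, t} : Set _))
    -- `σ² = g^(2i)` lies in `⟨g⟩`
    apply htg
    have : t = g ^ (2 * i) := by
      rw [ht, hij]
      rcases zpow_eq_one_or_eq_of_mul_self_eq_one htt j with h | h <;> rw [h]
      · rw [mul_one, ← zpow_add, two_mul]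
      · rw [show g ^ i * t * (g ^ i * t) = g ^ i * (t * g ^ i) * t by group, ← ((show Commute g t from hgt).zpow_left i).eq,
          show g ^ i * (g ^ i * t) * t = g ^ i * g ^ i * (t * t) by group, htt, mul_one, ← zpow_add, two_mul]
    rw [this]
    exact Subgroup.zpow_mem _ (Subgroup.mem_zpowers g) _
  -- the two cases
  have hog2 : orderOf (g ^ 2) = 2 ^ (n - 3) := by
    rw [orderOf_pow_of_dvd (by norm_num) (by rw [hg]; exact dvd_pow_self 2 (by omega)), hg,
      show 2 ^ (n - 2) = 2 ^ (n - 3) * 2 by rw [← pow_succ, show n - 3 + 1 = n - 2 by omega], Nat.mul_div_cancel _ (by norm_num)]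
  by_cases hcomm : g ^ 2 * σ = σ * g ^ 2
  · /- `σ` commutes with `g²`: `⟨g², σ⟩ ≅ C_{2^(n-3)} × C₄` of index `2` containing `c ≠ σ²` -/
    have hint : ∀ w : K ≃ₐ[ℚ] K, w ∈ Subgroup.zpowers (g ^ 2) → w ∈ Subgroup.zpowers σ → w = 1 := by
      intro w hwg hwσ
      obtain ⟨i, rfl⟩ := Subgroup.mem_zpowers_iff.1 hwσ
      have hwA : σ ^ i ∈ A := Subgroup.zpowers_le.2 (A.pow_mem hgA 2) hwg
      obtain ⟨k, hk | hk⟩ := Int.even_or_odd' i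
      · -- `σ^(2k) = t^k ∈ {1, t}`
        rw [hk, zpow_mul, zpow_two] at hwg ⊢
        rcases zpow_eq_one_or_eq_of_mul_self_eq_one htt k with h | h
        · exact h
        · exact absurd (Subgroup.zpowers_le.2 (Subgroup.npow_mem_zpowers g 2) (h ▸ hwg)) htg
      · -- `σ^(2k+1) ∈ A ⟹ σ ∈ A`
        exfalso
        apply hσA
        have htA : t ∈ A := Subgroup.mul_self_mem_of_index_two hAidx σ
        have e : σ = (t ^ k)⁻¹ * σ ^ i := by
          rw [hk, zpow_add, zpow_one, zpow_mul, zpow_two, ← ht]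
          group
        rw [e]
        exact A.mul_mem (A.inv_mem (A.zpow_mem htA k)) hwA
    have hidx : (Subgroup.closure ({g ^ 2, σ} : Set (K ≃ₐ[ℚ] K))).index = 2 :=
      index_closure_pair_eq_two hcomm hint (by
        rw [hcard, hog2, orderOf_eq_prime_pow (p := 2) (n := 1) (by rw [pow_one, pow_two]; exact hσ1)
          (by rw [show 2 ^ (1 + 1) = 4 by norm_num]; exact hσ),
          show (2 : ℕ) ^ n = 2 * (2 ^ (n - 3) * 2 ^ (1 + 1)) by rw [← pow_add, ← pow_succ']; congr 1; omega])
    have hcA' : c ∈ Subgroup.closure ({g ^ 2, σ} : Set (K ≃ₐ[ℚ] K)) := by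
      rw [hcg₀, show g ^ 2 ^ (n - 3) = (g ^ 2) ^ 2 ^ (n - 4) by
        rw [← pow_mul, ← pow_succ', show n - 4 + 1 = n - 3 by omega]]
      exact Subgroup.pow_mem _ (Subgroup.subset_closure (by simp)) _
    have := complexConj_eq_sq_of_cyclic_times_four_index_two hgood (g ^ 2) σ hcomm (by omega : 3 ≤ n - 3) hog2 hσ hσ1 hint
      hidx hcA'
    exact hσc this.symm
  · /- `σ` does not commute with `g²`: `σ⟨t⟩` is a non-central involution of `Gal/⟨t⟩` -/
    have htc : (MulEquiv.refl (K ≃ₐ[ℚ] K)) ((IsCMField.complexConj K).restrictScalars ℚ) ≠ t := by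
      rw [MulEquiv.refl_apply, ← hc]; exact fun h => hσc h.symm
    have h := mul_comm_mod_central_of_forall_isNondegenerate (MulEquiv.refl (K ≃ₐ[ℚ] K)) t htt hσ1 (fun x => (htcen x).symm)
      htc (by rw [hcardF]; omega) hgood σ g (Or.inr rfl)
    apply hcomm
    rcases h with h | h
    · -- `g σ = σ g`
      rw [mul_inv_eq_one] at h
      rw [pow_two, mul_assoc, h, ← mul_assoc, h, mul_assoc]
    · -- `g σ = t σ g`
      rw [mul_inv_eq_iff_eq_mul] at h
      calc g ^ 2 * σ = g * (g * σ) := by rw [pow_two, mul_assoc]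
        _ = g * (t * (σ * g)) := by rw [h]
        _ = t * (g * σ) * g := by rw [← mul_assoc, htcen g]; group
        _ = t * (t * (σ * g)) * g := by rw [h]
        _ = (t * t) * σ * (g * g) := by group
        _ = σ * g ^ 2 := by rw [htt, one_mul, pow_two]

/-- **STRUCT IN THE INDEX-TWO WORLD** (`n ≥ 7`, unconditional): `K` Galois CM of degree `2^n`, every primitive CM type nondegenerate,
`A ≤ Gal(K/ℚ)` abelian of index `2` containing `c` and an element of order `2^(n-2)` ⟹ `Gal(K/ℚ) = H·E` with `H.IsComplement' E`,
`E` central of exponent `2`, `|E| ≤ 2`, `c ∈ H ∖ E`, `H` cyclic or generalised quaternion. [cite: Rotman1995, Thm. 5.46]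
[cite: Shimura1998, §8.2 Prop. 26 and §18.2] [cite: Gordon1999HodgeAVSurvey, §9.3 and §9.4.3] -/
theorem struct_of_index_two_abelian {n : ℕ} (hdeg : Module.finrank ℚ K = 2 ^ n) (hn : 7 ≤ n)
    (hgood : ∀ (Φ : CMType K) (φ : K →+* ℂ), IsPrimitive (ℂ ≃+* ℂ) Φ.1 φ → IsNondegenerate Φ)
    (A : Subgroup (K ≃ₐ[ℚ] K)) (hAidx : A.index = 2) (hcommA : ∀ u ∈ A, ∀ v ∈ A, u * v = v * u)
    (hcA : (IsCMField.complexConj K).restrictScalars ℚ ∈ A) (g : K ≃ₐ[ℚ] K) (hgA : g ∈ A) (hg : orderOf g = 2 ^ (n - 2)) :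
    ∃ (H E : Subgroup (K ≃ₐ[ℚ] K)) (k : ℕ), H.IsComplement' E ∧ (IsCMField.complexConj K).restrictScalars ℚ ∈ H ∧
      (IsCMField.complexConj K).restrictScalars ℚ ∉ E ∧ (∀ e ∈ E, e * e = 1 ∧ ∀ x : K ≃ₐ[ℚ] K, x * e = e * x) ∧
      Nat.card E ≤ 2 ∧ Nat.card H = 2 ^ k ∧ (IsCyclic H ∨ (3 ≤ k ∧ Nonempty (H ≃* QuaternionGroup (2 ^ (k - 2))))) :=
  exists_isComplement'_card_le_two_of_forall_isNondegenerate hdeg (by omega) hgood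
    (pow_four_sq_of_index_two_abelian hdeg hn hgood A hAidx hcommA hcA g hgA hg)

/-- **… as an equivalence**: for `K` Galois CM of degree `2^n`, `n ≥ 7`, with an abelian subgroup `A` of index `2` in `Gal(K/ℚ)`
containing `c` and an element of order `2^(n-2)`: every primitive CM type is nondegenerate **iff** `Gal(K/ℚ) = H·E` as above.
[cite: Rotman1995, Thm. 5.46] [cite: Kubota1965, §2 and §4 Lemma 2] [cite: Shimura1998, §8.2 Prop. 26 and §18.2] -/
theorem good_iff_struct_of_index_two_abelian {n : ℕ} (hdeg : Module.finrank ℚ K = 2 ^ n) (hn : 7 ≤ n)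
    (A : Subgroup (K ≃ₐ[ℚ] K)) (hAidx : A.index = 2) (hcommA : ∀ u ∈ A, ∀ v ∈ A, u * v = v * u)
    (hcA : (IsCMField.complexConj K).restrictScalars ℚ ∈ A) (g : K ≃ₐ[ℚ] K) (hgA : g ∈ A) (hg : orderOf g = 2 ^ (n - 2)) :
    (∀ (Φ : CMType K) (φ : K →+* ℂ), IsPrimitive (ℂ ≃+* ℂ) Φ.1 φ → IsNondegenerate Φ) ↔
      ∃ (H E : Subgroup (K ≃ₐ[ℚ] K)) (k : ℕ), H.IsComplement' E ∧ (IsCMField.complexConj K).restrictScalars ℚ ∈ H ∧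
        (IsCMField.complexConj K).restrictScalars ℚ ∉ E ∧ (∀ e ∈ E, e * e = 1 ∧ ∀ x : K ≃ₐ[ℚ] K, x * e = e * x) ∧
        Nat.card E ≤ 2 ∧ Nat.card H = 2 ^ k ∧ (IsCyclic H ∨ (3 ≤ k ∧ Nonempty (H ≃* QuaternionGroup (2 ^ (k - 2))))) := by
  refine ⟨fun hgood => struct_of_index_two_abelian hdeg hn hgood A hAidx hcommA hcA g hgA hg, ?_⟩
  rintro ⟨H, E, k, hHE, hcH, -, hE, hEcard, hHcard, hstruct⟩ Φ φ hprim
  exact isNondegenerate_of_isPrimitive_of_struct hdeg (by omega) H E k hHE hcH hE hEcard hHcard hstruct φ hprim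

/-- **THE HODGE CONJECTURE in the index-two world** (`n ≥ 7`, unconditional): `K` Galois CM of degree `2^n`, every primitive CM type
nondegenerate, `Gal(K/ℚ)` with an abelian subgroup of index `2` containing `c` and an element of order `2^(n-2)`; then HC holds for
`⨁_{Fin N} A` for every abelian variety `A` realising any CM type of `K`. [cite: Gordon1999HodgeAVSurvey, Thm. 6.4, §9.3 and §9.4.3]
[cite: Shimura1998, §5.1 Prop. 3 and §8.2 Prop. 26] -/
theorem hodgeConjectureFor_pow_of_index_two_abelian {n : ℕ} (hdeg : Module.finrank ℚ K = 2 ^ n) (hn : 7 ≤ n)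
    (hgood : ∀ (Φ : CMType K) (φ : K →+* ℂ), IsPrimitive (ℂ ≃+* ℂ) Φ.1 φ → IsNondegenerate Φ)
    (A : Subgroup (K ≃ₐ[ℚ] K)) (hAidx : A.index = 2) (hcommA : ∀ u ∈ A, ∀ v ∈ A, u * v = v * u)
    (hcA : (IsCMField.complexConj K).restrictScalars ℚ ∈ A) (g : K ≃ₐ[ℚ] K) (hgA : g ∈ A) (hg : orderOf g = 2 ^ (n - 2))
    {Φ : CMType K} {X : AbelianVariety ℂ} {ι : 𝓞 K →+* End X} {θ : K →+* Module.End ℂ (complexBetti X.X 1)}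
    (hX : Literature.AlgebraicGeometry.ComplexMultiplication.IsCMTypeRealisation Φ X ι θ) (N : ℕ) :
    HodgeConjectureFor (⨁ fun _ : Fin N => X).dim (⨁ fun _ : Fin N => X).X := by
  obtain ⟨H, E, k, hHE, hcH, -, hE, hEcard, hHcard, hstruct⟩ :=
    struct_of_index_two_abelian hdeg hn hgood A hAidx hcommA hcA g hgA hg
  exact hodgeConjectureFor_pow_of_struct hdeg (by omega) H E k hHE hcH hE hEcard hHcard hstruct hX N

end Summit.HodgeConjecture.CorCM.GaloisModels
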